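import Summits.ValiantsHypothesis.ValiantsHypothesis.Theorems.SymPencilPerFourPeeledCornerSwapPairsVectors

/-!
# Route `SymPencil` — `2 | 2` inner rank of `per_4`, PEELED case at `≤ 11` squares: the
# DOUBLE-SWAP CORNER on two DIFFERENT pairs is EMPTY (`--supports` stmt-ValiantsHypothesis-5674
# `SdcSuperquadratic`; (8,8) column, cell (8,8,11); memo `NOTE-p6g16-5674-corner-double-swap.md`
# §1 "different pairs: dead by counting"; rung currency only)

Setting (memo §0): a reduced peeled family `t` on `|κ| ≤ 11` squares with weights `c`, scalar outer
blocks along `v₀, v₀'` (`⟨v₀,v₀'⟩ = λ ≠ 0`), whose `a`-side correction is the pure swap on the pair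
`{0,1}`, `t(a,0)(x,0) = u₀(a₀x₁ + a₁x₀)·v₀`, and whose `b`-side correction is the pure swap on a
DIFFERENT pair `{k,l}`, `t(0,b)(0,x) = u₁(b_k x_l + b_l x_k)·v₀'`.  With `ν_by = t((0,e_b),(e_y,0))`,
`μ_az = t((e_a,0),(0,e_z))` the cross pairings are
`⟨μ_az, ν_by⟩ = ½[a,b,y,z distinct] − u₀u₁λ·S₀₁[a,y]·S_kl[b,z]` and `ν ⟂ v₀, v₀'`, `μ ⟂ v₀, v₀'`.

**Theorem** (`false_of_swap01_core`, the two representative pairs `{k,l} = {2,3}` (disjoint) and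
`{k,l} = {0,2}` (adjacent)): such a family does not exist, because ten of the `ν`'s together with
`v₀, v₀'` are TWELVE linearly independent vectors in `K^κ`, `|κ| ≤ 11`
(`…CornerSwapPairsVectors.linearIndependent_twelve_swap23 / _swap02`).  The remaining pairs and the
`S₄`-relabelled corners follow by transport in the sequel file; the same pair is
`…CornerSwapSamePair.false_of_double_swap_same_pair` (val-lit-p6 g16).

Honest framing: corner bookkeeping of the (8,8,11) case analysis; no cell closes here (the cell
still needs the COVERAGE theorem "frameless ⇒ pure swap"); `28 ≤ sdc(per_4) ≤ 29` of record, the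
crux `SdcSuperquadratic` and `VP ≠ VNP` are untouched.  The Gram bookkeeping block is val-lit-p8
g15's (`…TwoPencilDesign`), as in the two predecessor files.  No definitions, no named facts.
[folklore]
-/

noncomputable section

-- single-conjunct layout: Sub = Summit, duplicated namespace component intended
set_option linter.dupNamespace false

namespace Summit.ValiantsHypothesis.ValiantsHypothesis.Theorems.SymPencilPerFourPeeledCornerSwapPairs

open Matrix Finset Module
open Summit.ValiantsHypothesis.ValiantsHypothesis.Theorems.SymPencilPerFourInnerRankRows
open Summit.ValiantsHypothesis.ValiantsHypothesis.Theorems.SymPencilPerFourInnerRankTenPairs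
open Summit.ValiantsHypothesis.ValiantsHypothesis.Theorems.SymPencilPerFourInnerRankScalarBlock
open Summit.ValiantsHypothesis.ValiantsHypothesis.Theorems.SymPencilPerFourInnerRankReducedFamily
open Summit.ValiantsHypothesis.ValiantsHypothesis.Theorems.SymPencilPerFourPeeledFrame
open Summit.ValiantsHypothesis.ValiantsHypothesis.Theorems.SymPencilPerFourPeeledTwoPencilDesign
open Summit.ValiantsHypothesis.ValiantsHypothesis.Theorems.SymPencilPerFourPeeledTenCaseA
open Summit.ValiantsHypothesis.ValiantsHypothesis.Theorems.SymPencilPerFourPeeledCornerSwapPairsVectors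

universe u v

variable {K : Type u} [Field K]

/-- **The double-swap corner on two different pairs is empty** — representative pairs
`{k,l} = {2,3}` and `{k,l} = {0,2}` against `{0,1}`.  See the module docstring. [folklore] -/
theorem false_of_swap01_core [CharZero K] {κ : Type v} [Fintype κ] [DecidableEq κ]
    (hκ : Fintype.card κ ≤ 11) (c : κ → K)
    (t : κ → (((Fin 4 → K) × (Fin 4 → K)) →ₗ[K] ((Fin 4 → K) × (Fin 4 → K)) →ₗ[K] K))
    (hJ : ∀ a b y₂ y₃ : Fin 4 → K,
      ∑ r, c r * (t r (a, b) (y₂, y₃)) ^ 2 = (Matrix.of ![a, b, y₂, y₃]).permanent)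
    (v₀ v₀' : κ → K) (hv₀ : ∀ (a x : Fin 4 → K), ∃ s : K, (fun r => t r (a, 0) (x, 0)) = s • v₀)
    (hv₀' : ∀ (b x : Fin 4 → K), ∃ s : K, (fun r => t r (0, b) (0, x)) = s • v₀')
    (hpeel : ∃ a b y z : Fin 4 → K, ∑ r, c r * t r (a, 0) (y, 0) * t r (0, b) (0, z) ≠ 0)
    (u₀ u₁ : K) (k l : Fin 4) (hkl : (k = 2 ∧ l = 3) ∨ (k = 0 ∧ l = 2))
    (hψ : ∀ (a x : Fin 4 → K) r, t r (a, 0) (x, 0) = u₀ * (a 0 * x 1 + a 1 * x 0) * v₀ r)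
    (hψ' : ∀ (b x : Fin 4 → K) r, t r (0, b) (0, x) = u₁ * (b k * x l + b l * x k) * v₀' r) :
    False := by
  classical
  -- ===== Gram bookkeeping, verbatim after `…TwoPencilDesign.twelve_le_card_of_frame` =====
  have t00 : ∀ r (p : (Fin 4 → K) × (Fin 4 → K)), t r ((0 : Fin 4 → K), (0 : Fin 4 → K)) p = 0 :=
    fun r p => by rw [show ((0 : Fin 4 → K), (0 : Fin 4 → K)) = (0 : (Fin 4 → K) × (Fin 4 → K))
      from rfl, map_zero, LinearMap.zero_apply]
  have t00' : ∀ r (p : (Fin 4 → K) × (Fin 4 → K)), t r p ((0 : Fin 4 → K), (0 : Fin 4 → K)) = 0 :=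
    fun r p => by rw [show ((0 : Fin 4 → K), (0 : Fin 4 → K)) = (0 : (Fin 4 → K) × (Fin 4 → K))
      from rfl, map_zero]
  obtain ⟨a', b', yy, zz, hne⟩ := hpeel
  have hv0facts : (∑ r, c r * v₀ r ^ 2 = 0) ∧
      (∀ (a y : Fin 4 → K), ∑ r, c r * v₀ r * t r (a, 0) (0, y) = 0) ∧
      (∀ (b x : Fin 4 → K), ∑ r, c r * v₀ r * t r (0, b) (x, 0) = 0) := by
    rcases scalar_block_dichotomy c t hJ v₀ hv₀ with hz | h
    · exact absurd (Finset.sum_eq_zero fun r _ => by rw [hz a' yy r]; ring) hne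
    · exact h
  obtain ⟨hQv, hA₃, hB₂⟩ := hv0facts
  set tS : κ → (((Fin 4 → K) × (Fin 4 → K)) →ₗ[K] ((Fin 4 → K) × (Fin 4 → K)) →ₗ[K] K) :=
    fun r => ((t r).compl₁₂ (LinearEquiv.prodComm K (Fin 4 → K) (Fin 4 → K)).toLinearMap
      LinearMap.id).compl₂ (LinearEquiv.prodComm K (Fin 4 → K) (Fin 4 → K)).toLinearMap with htS
  have hJS : ∀ a b y₂ y₃ : Fin 4 → K,
      ∑ r, c r * (tS r (a, b) (y₂, y₃)) ^ 2 = (Matrix.of ![a, b, y₂, y₃]).permanent :=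
    hJ_yswap c _ (hJ_swap c t hJ)
  have htSap : ∀ r (a b y₂ y₃ : Fin 4 → K), tS r (a, b) (y₂, y₃) = t r (b, a) (y₃, y₂) :=
    fun r a b y₂ y₃ => by simp [htS]
  have hv0'facts : (∑ r, c r * v₀' r ^ 2 = 0) ∧
      (∀ (b y : Fin 4 → K), ∑ r, c r * v₀' r * t r (0, b) (y, 0) = 0) ∧
      (∀ (a x : Fin 4 → K), ∑ r, c r * v₀' r * t r (a, 0) (0, x) = 0) := by
    rcases scalar_block_dichotomy c tS hJS v₀' (fun b x => by
        obtain ⟨s, hs⟩ := hv₀' b x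
        exact ⟨s, by rw [← hs]; funext r; exact htSap r b 0 x 0⟩) with hz | ⟨h1, h2, h3⟩
    · refine absurd (Finset.sum_eq_zero fun r _ => ?_) hne
      have := hz b' zz r; rw [htSap] at this; rw [this]; ring
    · refine ⟨h1, fun b y => ?_, fun a x => ?_⟩
      · have := h2 b y; simpa only [htSap] using this
      · have := h3 a x; simpa only [htSap] using this
  obtain ⟨hQv', hB₂', hA₃'⟩ := hv0'facts
  have hlam : ∑ r, c r * v₀ r * v₀' r ≠ 0 := by
    obtain ⟨s, hs⟩ := hv₀ a' yy
    obtain ⟨s', hs'⟩ := hv₀' b' zz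
    have e1 : ∀ r, t r (a', 0) (yy, 0) = s * v₀ r := fun r => by
      have := congr_fun hs r; simpa using this
    have e2 : ∀ r, t r (0, b') (0, zz) = s' * v₀' r := fun r => by
      have := congr_fun hs' r; simpa using this
    intro h0
    apply hne
    have : ∑ r, c r * t r (a', 0) (yy, 0) * t r (0, b') (0, zz) =
        s * s' * ∑ r, c r * v₀ r * v₀' r := by
      rw [Finset.mul_sum]; exact Finset.sum_congr rfl fun r _ => by rw [e1, e2]; ring
    rw [this, h0, mul_zero]
  let ν : (Fin 4 → K) →ₗ[K] (Fin 4 → K) →ₗ[K] (κ → K) :=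
    LinearMap.mk₂ K (fun b y => fun r => t r (0, b) (y, 0))
      (fun b b' y => by
        funext r
        have : (((0 : Fin 4 → K), b + b') : (Fin 4 → K) × (Fin 4 → K)) = (0, b) + (0, b') := by simp
        simp only [Pi.add_apply, this, map_add, LinearMap.add_apply])
      (fun s b y => by
        funext r
        have : (((0 : Fin 4 → K), s • b) : (Fin 4 → K) × (Fin 4 → K)) = s • (0, b) := by simp
        simp only [Pi.smul_apply, this, map_smul, LinearMap.smul_apply, smul_eq_mul])
      (fun b y y' => by
        funext r
        have : ((y + y', (0 : Fin 4 → K)) : (Fin 4 → K) × (Fin 4 → K)) = (y, 0) + (y', 0) := by simp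
        simp only [Pi.add_apply, this, map_add])
      (fun s b y => by
        funext r
        have : ((s • y, (0 : Fin 4 → K)) : (Fin 4 → K) × (Fin 4 → K)) = s • (y, 0) := by simp
        simp only [Pi.smul_apply, this, map_smul, smul_eq_mul])
  have hνap : ∀ b y r, ν b y r = t r (0, b) (y, 0) := fun b y r => rfl
  let μ : (Fin 4 → K) →ₗ[K] (Fin 4 → K) →ₗ[K] (κ → K) :=
    LinearMap.mk₂ K (fun a z => fun r => t r (a, 0) (0, z))
      (fun a a' z => by
        funext r
        have : ((a + a', (0 : Fin 4 → K)) : (Fin 4 → K) × (Fin 4 → K)) = (a, 0) + (a', 0) := by simp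
        simp only [Pi.add_apply, this, map_add, LinearMap.add_apply])
      (fun s a z => by
        funext r
        have : ((s • a, (0 : Fin 4 → K)) : (Fin 4 → K) × (Fin 4 → K)) = s • (a, 0) := by simp
        simp only [Pi.smul_apply, this, map_smul, LinearMap.smul_apply, smul_eq_mul])
      (fun a z z' => by
        funext r
        have : (((0 : Fin 4 → K), z + z') : (Fin 4 → K) × (Fin 4 → K)) = (0, z) + (0, z') := by simp
        simp only [Pi.add_apply, this, map_add])
      (fun s a z => by
        funext r
        have : (((0 : Fin 4 → K), s • z) : (Fin 4 → K) × (Fin 4 → K)) = s • (0, z) := by simp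
        simp only [Pi.smul_apply, this, map_smul, smul_eq_mul])
  have hμap : ∀ a z r, μ a z r = t r (a, 0) (0, z) := fun a z r => rfl
  have hred := reduced_identity_of_scalar c t hJ v₀ v₀' hv₀ hv₀'
  have hνiso : ∀ b y, ∑ r, c r * ν b y r * ν b y r = 0 := by
    intro b y
    have h := hred 0 b y 0
    simp only [t00, t00', add_zero, mul_zero, Finset.sum_const_zero, sub_zero,
      per_zero_row₀] at h
    rw [← h]
    exact Finset.sum_congr rfl fun r _ => by rw [hνap]; ring
  have hμiso : ∀ a z, ∑ r, c r * μ a z r * μ a z r = 0 := by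
    intro a z
    have h := hred a 0 0 z
    simp only [t00, t00', zero_add, mul_zero, Finset.sum_const_zero, sub_zero,
      per_zero_row₂] at h
    rw [← h]
    exact Finset.sum_congr rfl fun r _ => by rw [hμap]; ring
  have hX : ∀ a b y z, 2 * ∑ r, c r * ν b y r * μ a z r =
      (Matrix.of ![a, b, y, z]).permanent - 2 * ∑ r, c r * t r (a, 0) (y, 0) * t r (0, b) (0, z) := by
    intro a b y z
    have h := hred a b y z
    have e : ∑ r, c r * (t r (0, b) (y, 0) + t r (a, 0) (0, z)) ^ 2 =
        ∑ r, c r * ν b y r * ν b y r + ∑ r, c r * μ a z r * μ a z r +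
          2 * ∑ r, c r * ν b y r * μ a z r := by
      rw [Finset.mul_sum, ← Finset.sum_add_distrib, ← Finset.sum_add_distrib]
      exact Finset.sum_congr rfl fun r _ => by rw [hνap, hμap]; ring
    rw [e, hνiso, hμiso, zero_add, zero_add] at h
    exact h
  -- ===== memo §1: cross pairings and the twelve independent vectors =====
  have hcorr : ∀ a b y z : Fin 4, ∑ r, c r * t r (Pi.single a 1, 0) (Pi.single y 1, 0) *
      t r (0, Pi.single b 1) (0, Pi.single z 1) =
      u₀ * ((Pi.single a 1 : Fin 4 → K) 0 * (Pi.single y 1 : Fin 4 → K) 1 +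
        (Pi.single a 1 : Fin 4 → K) 1 * (Pi.single y 1 : Fin 4 → K) 0) *
      (u₁ * ((Pi.single b 1 : Fin 4 → K) k * (Pi.single z 1 : Fin 4 → K) l +
        (Pi.single b 1 : Fin 4 → K) l * (Pi.single z 1 : Fin 4 → K) k)) *
      ∑ r, c r * v₀ r * v₀' r := by
    intro a b y z
    rw [Finset.mul_sum]
    exact Finset.sum_congr rfl fun r _ => by rw [hψ, hψ']; ring
  have hMN : ∀ a b y z : Fin 4,
      ∑ r, c r * (fun a z => μ (Pi.single a 1) (Pi.single z 1)) a z r *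
        (fun b y => ν (Pi.single b 1) (Pi.single y 1)) b y r =
      (if (a ≠ b ∧ a ≠ y ∧ a ≠ z ∧ b ≠ y ∧ b ≠ z ∧ y ≠ z) then (1 / 2 : K) else 0) -
      (u₀ * u₁) * ((Pi.single a 1 : Fin 4 → K) 0 * (Pi.single y 1 : Fin 4 → K) 1 +
        (Pi.single a 1 : Fin 4 → K) 1 * (Pi.single y 1 : Fin 4 → K) 0) *
      ((Pi.single b 1 : Fin 4 → K) k * (Pi.single z 1 : Fin 4 → K) l +
        (Pi.single b 1 : Fin 4 → K) l * (Pi.single z 1 : Fin 4 → K) k) *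
      ∑ r, c r * v₀ r * v₀' r := by
    intro a b y z
    have h := hX (Pi.single a 1) (Pi.single b 1) (Pi.single y 1) (Pi.single z 1)
    rw [per_basis, hcorr] at h
    rw [wdot_comm]
    split_ifs at h ⊢ <;> linear_combination h / 2
  -- u₀ ≠ 0, u₁ ≠ 0
  have hu₀ : u₀ ≠ 0 := by
    rintro rfl; apply hne
    exact Finset.sum_eq_zero fun r _ => by rw [hψ]; ring
  have hu₁ : u₁ ≠ 0 := by
    rintro rfl; apply hne
    exact Finset.sum_eq_zero fun r _ => by rw [hψ']; ring
  have hv0v0 : ∑ r, c r * v₀ r * v₀ r = 0 := by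
    rw [← hQv]; exact Finset.sum_congr rfl fun r _ => by ring
  have hv0'v0' : ∑ r, c r * v₀' r * v₀' r = 0 := by
    rw [← hQv']; exact Finset.sum_congr rfl fun r _ => by ring
  have hMv0 : ∀ a z : Fin 4, ∑ r, c r * (fun a z => μ (Pi.single a 1) (Pi.single z 1)) a z r *
      v₀ r = 0 := fun a z => by rw [wdot_comm]; exact hA₃ _ _
  have hMv0' : ∀ a z : Fin 4, ∑ r, c r * (fun a z => μ (Pi.single a 1) (Pi.single z 1)) a z r *
      v₀' r = 0 := fun a z => by rw [wdot_comm]; exact hA₃' _ _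
  have hv0N : ∀ b y : Fin 4, ∑ r, c r * v₀ r *
      (fun b y => ν (Pi.single b 1) (Pi.single y 1)) b y r = 0 := fun b y => hB₂ _ _
  have hv0'N : ∀ b y : Fin 4, ∑ r, c r * v₀' r *
      (fun b y => ν (Pi.single b 1) (Pi.single y 1)) b y r = 0 := fun b y => hB₂' _ _
  have hv0'v0 : ∑ r, c r * v₀' r * v₀ r = ∑ r, c r * v₀ r * v₀' r := wdot_comm _ _ _
  have hfin : ∀ w : Fin 12 → κ → K, LinearIndependent K w → False := fun w hli => by
    have h := hli.fintype_card_le_finrank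
    simp only [Fintype.card_fin, Module.finrank_fintype_fun_eq_card] at h
    omega
  rcases hkl with ⟨rfl, rfl⟩ | ⟨rfl, rfl⟩
  · exact hfin _ (linearIndependent_twelve_swap23 c
      (fun b y => ν (Pi.single b 1) (Pi.single y 1)) (fun a z => μ (Pi.single a 1) (Pi.single z 1))
      v₀ v₀' (u₀ * u₁) (∑ r, c r * v₀ r * v₀' r) hMN hMv0 hMv0' hv0N hv0'N hv0v0 hv0'v0' rfl
      hv0'v0 (mul_ne_zero hu₀ hu₁) hlam)
  · exact hfin _ (linearIndependent_twelve_swap02 c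
      (fun b y => ν (Pi.single b 1) (Pi.single y 1)) (fun a z => μ (Pi.single a 1) (Pi.single z 1))
      v₀ v₀' (u₀ * u₁) (∑ r, c r * v₀ r * v₀' r) hMN hMv0 hMv0' hv0N hv0'N hv0v0 hv0'v0' rfl
      hv0'v0 (mul_ne_zero hu₀ hu₁) hlam)

end Summit.ValiantsHypothesis.ValiantsHypothesis.Theorems.SymPencilPerFourPeeledCornerSwapPairs

end
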